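import Literature.Analysis.FunctionSpaces.PoissonPointProcess
import Mathlib.Data.Set.Card.Arithmetic
import HarnessLib

/-!
# Poisson point processes: uniqueness of the law (Rényi–Kingman)

(topic Analysis/FunctionSpaces; DISCHARGES the named fact
`Literature.Analysis.FunctionSpaces.IsPoissonPointProcess.unique` of
`Literature.Analysis.FunctionSpaces.PoissonPointProcess` as `IsPoissonPointProcess.unique_holds`.)

Main result: `IsPoissonPointProcess.unique_holds` — two Poisson point processes (laws on locally
finite simple configurations, `IsPoissonPointProcess ν P`) with the same σ-finite intensity `ν`
coincide.

The proof is Kingman's remark following (2.4) (J. F. C. Kingman, *Poisson Processes* (1993), §2.1,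
p. 12, display (2.5)): "If we know the mean measure we can write down, using (i) and (ii), all the
joint distributions of the counts `N(A)` for different sets `A`": for measurable `A₁, …, Aₙ` of
finite intensity the `2ⁿ` sets `B = A₁* ∩ ⋯ ∩ Aₙ*` (`Aⱼ* = Aⱼ` or its complement) are pairwise
disjoint, `N(Aⱼ) = Σ_{B ⊆ Aⱼ} N(B)` (2.5), and the `N(B)` are independent Poisson variables with
known means; hence the joint law of `(N(A₁), …, N(Aₙ))` is determined by `ν`
(`IsPoissonPointProcess.map_counts_eq`). The events `{(N(A₁), …, N(Aₙ)) ∈ B}` over measurable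
`Aⱼ` of finite intensity form a π-system which, for σ-finite `ν`, generates the σ-algebra of
configurations (`generateFrom_countCylinders`: `{a ≤ N(A)} = ⋃ₘ {a ≤ N(A ∩ Sₘ)}` along spanning
sets `Sₘ`), so two probability laws satisfying (i)–(ii) agree (`MeasureTheory.ext_of_generate_finite`).
This is the uniqueness half of Rényi's characterisation as used in the tree
(A. Rényi, *Remarks on the Poisson process* (1967); Kingman 1993, §3.4).

No new definitions, no new named facts.

## References

* J. F. C. Kingman, *Poisson Processes*, Oxford Studies in Probability 3, Oxford University Press
  (1993), §2.1, pp. 11–13, displays (2.4)–(2.5). [cite: Kingman1993, §2.1]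
* A. Rényi, Remarks on the Poisson process, *Studia Sci. Math. Hungar.* 2 (1967), 119–123.
  [cite: Renyi1967]
-/

open MeasureTheory ProbabilityTheory Set
open scoped ENNReal NNReal

namespace Literature.Analysis.FunctionSpaces

variable {E : Type*} [TopologicalSpace E] [MeasurableSpace E]

/-! ### The atoms `A₁* ∩ ⋯ ∩ Aₙ*` of finitely many sets -/

section Atoms

variable {κ : Type*}

omit [TopologicalSpace E] [MeasurableSpace E] in
/-- The atoms `{x | ∀ j, x ∈ s j ↔ σ j}` (intersected with `⋃ j, s j`) of a finite family of sets,
indexed by sign patterns `σ`, are pairwise disjoint (Kingman 1993, §2.1, p. 12: "There are `2ⁿ` of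
these, and they are disjoint"). [cite: Kingman1993, §2.1, p. 12] -/
theorem pairwise_disjoint_atoms (s : κ → Set E) :
    Pairwise (Function.onFun Disjoint
      fun σ : κ → Bool => {x | ∀ j, x ∈ s j ↔ σ j = true} ∩ ⋃ j, s j) := by
  intro σ τ hne
  rw [Function.onFun, Set.disjoint_left]
  rintro x ⟨hσ, -⟩ ⟨hτ, -⟩
  refine hne (funext fun j => ?_)
  exact Bool.eq_iff_iff.2 ((hσ j).symm.trans (hτ j))

omit [TopologicalSpace E] [MeasurableSpace E] in
/-- Each set of a finite family is the (disjoint) union of the atoms whose pattern contains it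
(Kingman 1993, §2.1, p. 12: `Aⱼ = ⋃_{i ∈ γⱼ} Bᵢ`). [cite: Kingman1993, §2.1, p. 12] -/
theorem eq_iUnion_atoms (s : κ → Set E) (i : κ) :
    s i = ⋃ σ : {σ : κ → Bool // σ i = true},
      ({x | ∀ j, x ∈ s j ↔ σ.1 j = true} ∩ ⋃ j, s j) := by
  classical
  ext x
  simp only [Set.mem_iUnion, Set.mem_inter_iff, Set.mem_setOf_eq]
  constructor
  · intro hx
    exact ⟨⟨fun j => decide (x ∈ s j), by simpa using hx⟩, fun j => by simp, ⟨i, hx⟩⟩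
  · rintro ⟨σ, hσ, -⟩
    exact (hσ i).2 σ.2

omit [TopologicalSpace E] in
/-- The atoms of a countable family of measurable sets are measurable. [folklore] -/
theorem measurableSet_atom [Countable κ] {s : κ → Set E} (hs : ∀ j, MeasurableSet (s j))
    (σ : κ → Bool) :
    MeasurableSet ({x | ∀ j, x ∈ s j ↔ σ j = true} ∩ ⋃ j, s j) := by
  rw [Set.setOf_forall]
  refine (MeasurableSet.iInter fun j => ?_).inter (MeasurableSet.iUnion hs)
  cases σ j
  · simp only [Bool.false_eq_true, iff_false]
    exact (hs j).compl
  · simp only [iff_true]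
    exact hs j

omit [TopologicalSpace E] in
/-- The atoms of a finite family of sets of finite measure have finite measure. [folklore] -/
theorem measure_atom_ne_top [Fintype κ] {ν : Measure E} {s : κ → Set E}
    (hfin : ∀ j, ν (s j) ≠ ∞) (σ : κ → Bool) :
    ν ({x | ∀ j, x ∈ s j ↔ σ j = true} ∩ ⋃ j, s j) ≠ ∞ := by
  refine ne_top_of_le_ne_top ?_ (measure_mono Set.inter_subset_right)
  exact ((measure_iUnion_fintype_le ν s).trans_lt
    (ENNReal.sum_lt_top.2 fun j _ => (hfin j).lt_top)).ne

end Atoms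

namespace PointConfig

omit [MeasurableSpace E] in
/-- **Finite additivity of the counts**: for finitely many pairwise disjoint sets,
`N(⋃ᵢ tᵢ) = Σᵢ N(tᵢ)` (Kingman 1993, §2.1, (2.4)–(2.5)). [cite: Kingman1993, §2.1, (2.5)] -/
theorem count_iUnion_of_fintype {ι : Type*} [Fintype ι] (c : PointConfig E) {t : ι → Set E}
    (hd : Pairwise (Function.onFun Disjoint t)) : c.count (⋃ i, t i) = ∑ i, c.count (t i) := by
  simp only [PointConfig.count, Set.inter_iUnion]
  rw [Set.encard_iUnion_of_finite, finsum_eq_sum_of_fintype]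
  exact fun i j hij => (hd hij).mono Set.inter_subset_right Set.inter_subset_right

omit [MeasurableSpace E] in
/-- **Kingman's display (2.5)**: the count of `s i` is the sum of the counts of the atoms contained
in `s i`. [cite: Kingman1993, §2.1, p. 12, (2.5)] -/
theorem count_eq_sum_count_atoms {κ : Type*} [Fintype κ] [DecidableEq κ] (c : PointConfig E)
    (s : κ → Set E) (i : κ) :
    c.count (s i) = ∑ σ : {σ : κ → Bool // σ i = true},
      c.count ({x | ∀ j, x ∈ s j ↔ σ.1 j = true} ∩ ⋃ j, s j) := by
  conv_lhs => rw [eq_iUnion_atoms s i]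
  rw [count_iUnion_of_fintype]
  exact fun σ τ hne => pairwise_disjoint_atoms s fun h => hne (Subtype.ext h)

omit [MeasurableSpace E] in
/-- Along an increasing sequence `S` exhausting the space, a configuration has at least `a` points
in `s` iff it has at least `a` points in some `s ∩ S m` (a finite set of points lies in some
`S m`). [folklore] -/
theorem natCast_le_count_iff_exists (c : PointConfig E) (s : Set E) {S : ℕ → Set E}
    (hmono : Monotone S) (hU : ⋃ m, S m = univ) (a : ℕ) :
    (a : ℕ∞) ≤ c.count s ↔ ∃ m, (a : ℕ∞) ≤ c.count (s ∩ S m) := by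
  constructor
  · intro ha
    obtain ⟨t, hts, hta⟩ := Set.exists_subset_encard_eq ha
    have htfin : t.Finite := Set.finite_of_encard_eq_coe hta
    obtain ⟨I, hIfin, htI⟩ := Set.finite_subset_iUnion htfin (t := S) (by rw [hU]; exact subset_univ t)
    obtain ⟨N, hN⟩ := hIfin.bddAbove
    refine ⟨N, ?_⟩
    rw [← hta]
    refine Set.encard_le_encard fun x hx => ⟨(hts hx).1, (hts hx).2, ?_⟩
    obtain ⟨m, hm, hxm⟩ := Set.mem_iUnion₂.1 (htI hx)
    exact hmono (hN hm) hxm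
  · rintro ⟨m, hm⟩
    exact hm.trans (c.count_mono (Set.inter_subset_left))

end PointConfig

/-! ### The joint laws of the counts are determined by the intensity -/

namespace IsPoissonPointProcess

variable {ν : Measure E} {P P' : Measure (PointConfig E)}

/-- **Joint law of the counts of disjoint sets**: for finitely many pairwise disjoint measurable
sets of finite intensity, the count vector of a Poisson point process has the product law
`⊗ₖ Poisson(ν tₖ)` (axioms (i)–(ii) of Kingman 1993, §2.1). [cite: Kingman1993, §2.1, p. 12] -/
theorem map_count_pi_eq (h : IsPoissonPointProcess ν P) {κ : Type*} [Fintype κ] {t : κ → Set E}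
    (ht : ∀ k, MeasurableSet (t k)) (hd : Pairwise (Function.onFun Disjoint t))
    (hfin : ∀ k, ν (t k) ≠ ∞) :
    P.map (fun c k => c.count (t k)) =
      Measure.pi fun k => (poissonMeasure (ν (t k)).toNNReal).map ((↑) : ℕ → ℕ∞) := by
  haveI := h.isProbabilityMeasure
  have hind : iIndepFun (fun k (c : PointConfig E) => c.count (t k)) P := by
    have h1 := h.iIndepFun_count (s := fun i => t ((Fintype.equivFin κ).symm i)) (fun i => ht _)
      (fun i j hij => hd ((Fintype.equivFin κ).symm.injective.ne hij))
    exact iIndepFun.of_precomp (Fintype.equivFin κ).symm.surjective h1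
  rw [(iIndepFun_iff_map_fun_eq_pi_map fun k =>
    (PointConfig.measurable_count (ht k)).aemeasurable).1 hind]
  congr 1
  funext k
  exact h.map_count (ht k) (hfin k)

/-- **The finite-dimensional laws of the counts are determined by the intensity** (Kingman 1993,
§2.1, p. 12: "If we know the mean measure we can write down, using (i) and (ii), all the joint
distributions of the counts `N(A)`", via the atoms and (2.5)): two Poisson point processes with
the same intensity have the same joint law of `(N(s₁), …, N(sₙ))` for measurable `sₖ` of finite
intensity. [cite: Kingman1993, §2.1, p. 12, (2.5)] -/
theorem map_counts_eq (h : IsPoissonPointProcess ν P) (h' : IsPoissonPointProcess ν P')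
    {κ : Type*} [Fintype κ] {s : κ → Set E} (hs : ∀ k, MeasurableSet (s k))
    (hfin : ∀ k, ν (s k) ≠ ∞) :
    P.map (fun c k => c.count (s k)) = P'.map (fun c k => c.count (s k)) := by
  classical
  set atom : (κ → Bool) → Set E := fun σ => {x | ∀ j, x ∈ s j ↔ σ j = true} ∩ ⋃ j, s j
    with hatom
  have hma : ∀ σ, MeasurableSet (atom σ) := fun σ => measurableSet_atom hs σ
  have hda : Pairwise (Function.onFun Disjoint atom) := pairwise_disjoint_atoms s
  have hfa : ∀ σ, ν (atom σ) ≠ ∞ := fun σ => measure_atom_ne_top hfin σ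
  set L : ((κ → Bool) → ℕ∞) → (κ → ℕ∞) :=
    fun v k => ∑ σ : {σ : κ → Bool // σ k = true}, v σ.1 with hL
  have hLm : Measurable L := measurable_of_countable L
  have hmeas : Measurable fun (c : PointConfig E) σ => c.count (atom σ) :=
    measurable_pi_lambda _ fun σ => PointConfig.measurable_count (hma σ)
  have hcomp : (fun (c : PointConfig E) k => c.count (s k)) = L ∘ fun c σ => c.count (atom σ) := by
    funext c k
    exact PointConfig.count_eq_sum_count_atoms c s k
  rw [hcomp, ← Measure.map_map hLm hmeas, ← Measure.map_map hLm hmeas,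
    h.map_count_pi_eq hma hda hfa, h'.map_count_pi_eq hma hda hfa]

/-- Two Poisson point processes with the same intensity give the same probability to every event
`{(N(s₁), …, N(sₙ)) ∈ B}` over measurable `sₖ` of finite intensity. [cite: Kingman1993, §2.1, p. 12, (2.5)] -/
theorem measure_preimage_counts_eq (h : IsPoissonPointProcess ν P) (h' : IsPoissonPointProcess ν P')
    {κ : Type*} [Fintype κ] {s : κ → Set E} (hs : ∀ k, MeasurableSet (s k))
    (hfin : ∀ k, ν (s k) ≠ ∞) (B : Set (κ → ℕ∞)) :
    P ((fun c k => c.count (s k)) ⁻¹' B) = P' ((fun c k => c.count (s k)) ⁻¹' B) := by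
  have hf : Measurable fun (c : PointConfig E) k => c.count (s k) :=
    measurable_pi_lambda _ fun k => PointConfig.measurable_count (hs k)
  have hB : MeasurableSet B := B.to_countable.measurableSet
  rw [← Measure.map_apply hf hB, ← Measure.map_apply hf hB, h.map_counts_eq h' hs hfin]

end IsPoissonPointProcess

/-! ### The count cylinders: a generating π-system -/

section Cylinders

variable (ν : Measure E)

/-- The events `{(N(s₁), …, N(sₙ)) ∈ B}` over finitely many measurable sets of finite intensity
form a π-system (concatenate the two families). [folklore] -/
theorem isPiSystem_countCylinders :
    IsPiSystem {A : Set (PointConfig E) | ∃ (κ : Type) (_ : Fintype κ) (s : κ → Set E)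
      (B : Set (κ → ℕ∞)), (∀ k, MeasurableSet (s k)) ∧ (∀ k, ν (s k) ≠ ∞) ∧
        A = (fun c k => c.count (s k)) ⁻¹' B} := by
  rintro A ⟨κ, hκ, s, B, hs, hfin, rfl⟩ A' ⟨κ', hκ', s', B', hs', hfin', rfl⟩ -
  refine ⟨κ ⊕ κ', inferInstance, Sum.elim s s',
    {v | (fun k => v (Sum.inl k)) ∈ B ∧ (fun k => v (Sum.inr k)) ∈ B'}, ?_, ?_, ?_⟩
  · rintro (k | k)
    · exact hs k
    · exact hs' k
  · rintro (k | k)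
    · exact hfin k
    · exact hfin' k
  · ext c
    simp

/-- Count cylinders are measurable events of configurations. [folklore] -/
theorem measurableSet_of_mem_countCylinders {A : Set (PointConfig E)}
    (hA : A ∈ {A : Set (PointConfig E) | ∃ (κ : Type) (_ : Fintype κ) (s : κ → Set E)
      (B : Set (κ → ℕ∞)), (∀ k, MeasurableSet (s k)) ∧ (∀ k, ν (s k) ≠ ∞) ∧
        A = (fun c k => c.count (s k)) ⁻¹' B}) :
    MeasurableSet A := by
  obtain ⟨κ, hκ, s, B, hs, -, rfl⟩ := hA
  exact (measurable_pi_lambda _ fun k => PointConfig.measurable_count (hs k))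
    B.to_countable.measurableSet

/-- **The count cylinders generate the σ-algebra of configurations** when the intensity is
σ-finite: for measurable `s` and `a : ℕ`, `{a ≤ N(s)} = ⋃ₘ {a ≤ N(s ∩ Sₘ)}` along the spanning
sets `Sₘ` of `ν`, which have finite intensity. [folklore] -/
theorem generateFrom_countCylinders [SigmaFinite ν] :
    MeasurableSpace.generateFrom {A : Set (PointConfig E) | ∃ (κ : Type) (_ : Fintype κ)
      (s : κ → Set E) (B : Set (κ → ℕ∞)), (∀ k, MeasurableSet (s k)) ∧ (∀ k, ν (s k) ≠ ∞) ∧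
        A = (fun c k => c.count (s k)) ⁻¹' B} =
      (PointConfig.instMeasurableSpace : MeasurableSpace (PointConfig E)) := by
  apply le_antisymm
  · exact MeasurableSpace.generateFrom_le fun A hA => measurableSet_of_mem_countCylinders ν hA
  · -- every counting map is measurable for the generated σ-algebra
    set C := {A : Set (PointConfig E) | ∃ (κ : Type) (_ : Fintype κ)
      (s : κ → Set E) (B : Set (κ → ℕ∞)), (∀ k, MeasurableSet (s k)) ∧ (∀ k, ν (s k) ≠ ∞) ∧
        A = (fun c k => c.count (s k)) ⁻¹' B} with hC
    change ⨆ (s : Set E) (_ : MeasurableSet s),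
      (⊤ : MeasurableSpace ℕ∞).comap (fun c : PointConfig E => c.count s) ≤ _
    refine iSup₂_le fun s hs => ?_
    rw [← measurable_iff_comap_le]
    -- the events `{a ≤ N(s ∩ Sₘ)}` are cylinders
    have hG : ∀ (a m : ℕ), MeasurableSet[MeasurableSpace.generateFrom C]
        {c : PointConfig E | (a : ℕ∞) ≤ c.count (s ∩ spanningSets ν m)} := by
      intro a m
      refine MeasurableSpace.measurableSet_generateFrom ⟨Unit, inferInstance,
        fun _ => s ∩ spanningSets ν m, {v | (a : ℕ∞) ≤ v ()}, fun _ => hs.inter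
          (measurableSet_spanningSets ν m), fun _ => ?_, ?_⟩
      · exact ((measure_mono Set.inter_subset_right).trans_lt
          (measure_spanningSets_lt_top ν m)).ne
      · ext c
        simp
    -- hence so are the events `{a ≤ N(s)}`
    have hG' : ∀ a : ℕ, MeasurableSet[MeasurableSpace.generateFrom C]
        {c : PointConfig E | (a : ℕ∞) ≤ c.count s} := by
      intro a
      have : {c : PointConfig E | (a : ℕ∞) ≤ c.count s} =
          ⋃ m, {c : PointConfig E | (a : ℕ∞) ≤ c.count (s ∩ spanningSets ν m)} := by
        ext c
        simp only [Set.mem_setOf_eq, Set.mem_iUnion]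
        exact c.natCast_le_count_iff_exists s (monotone_spanningSets ν) (iUnion_spanningSets ν) a
      rw [this]
      exact MeasurableSet.iUnion fun m => hG a m
    -- and the level sets `{N(s) = a}`, `a : ℕ`
    refine (@ENat.measurable_iff _ (MeasurableSpace.generateFrom C) _).2 fun a => ?_
    have : (fun c : PointConfig E => c.count s) ⁻¹' {(a : ℕ∞)} =
        {c : PointConfig E | (a : ℕ∞) ≤ c.count s} \
          {c : PointConfig E | ((a + 1 : ℕ) : ℕ∞) ≤ c.count s} := by
      ext c
      simp only [Set.mem_preimage, Set.mem_singleton_iff, Set.mem_sdiff, Set.mem_setOf_eq, not_le,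
        Nat.cast_add, Nat.cast_one]
      constructor
      · intro hc
        rw [hc]
        exact ⟨le_rfl, ENat.coe_lt_coe.2 (Nat.lt_succ_self a)|>.trans_eq' (by simp)⟩
      · rintro ⟨h1, h2⟩
        exact le_antisymm ((ENat.lt_add_one_iff (ENat.coe_ne_top a)).1 (by simpa using h2)) h1
    rw [this]
    exact (hG' a).diff (hG' (a + 1))

end Cylinders

/-! ### Uniqueness -/

namespace IsPoissonPointProcess

variable {ν : Measure E} {P : Measure (PointConfig E)}

/-- **Uniqueness of the Poisson point process with given σ-finite intensity** (discharge of the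
named fact `IsPoissonPointProcess.unique`; Rényi 1967, Kingman 1993, §2.1, p. 12 and §3.4): two
laws on locally finite configurations satisfying Kingman's axioms (i)–(ii) with the same σ-finite
intensity agree on the π-system of count cylinders over sets of finite intensity (the joint laws of
the counts are determined via the atoms, display (2.5)), which generates the σ-algebra of
configurations; both being probability measures, they are equal. [cite: Kingman1993, §2.1, p. 12, (2.5); §3.4] -/
theorem unique_holds : IsPoissonPointProcess.unique (ν := ν) (P := P) := by
  intro _ P' h h'
  haveI := h.isProbabilityMeasure
  haveI := h'.isProbabilityMeasure
  refine ext_of_generate_finite _ (generateFrom_countCylinders ν).symm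
    (isPiSystem_countCylinders ν) ?_ (by simp)
  rintro A ⟨κ, hκ, s, B, hs, hfin, rfl⟩
  exact h.measure_preimage_counts_eq h' hs hfin B

end IsPoissonPointProcess

end Literature.Analysis.FunctionSpaces
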